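import Literature.AlgebraicGeometry.Frobenioids.DirectSumPrimes
import Literature.AlgebraicGeometry.Frobenioids.RlfPerfFactorial
import HarnessLib

/-!
# Frobenioids I, Def. 2.4 (i)(c)(d) for a direct sum `⊕_i M_i` of monoprime monoids, relative to its primes

Mochizuki, *The geometry of Frobenioids I*, Kyushu J. Math. **62** (2008), §2, Definition 2.4 (i) p. 47
(conditions (c): the factorization homomorphism `a ↦ (sup Bound_{𝔭 ∪ {0}}(a))_𝔭` is a well-defined injective
homomorphism into `∏_𝔭 M_𝔭 ⊗ ℝ_{≥0}` with image in `∏_𝔭 M_𝔭`, and (d): support condition), Ex. 6.1 p. 109 /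
Ex. 6.3 p. 113 ("`Φ(L)` is perf-factorial") [cite: MochizukiFrdI2008, Def. 2.4(i) p.47]
[cite: MochizukiFrdI2008, Ex. 6.3 p.113].

For `Q = ⊕_i M_i` with MONOPRIME `M_i` (`DirectSumMonoids.lean`, `DirectSumPrimes.lean`: `Prime(Q) ≃ ι`,
`Q_𝔭 = {supp ⊆ {i}} ≅ M_i`): the supremum defining the `𝔭`-component of the factorization map is ATTAINED at
the restriction `a|_i = single i (a i)` (`fmap_apply`), the factorization map is `a ↦ (a|_i ⊗ 1)_𝔭` — a
homomorphism, injective, with image in `∏ Q_𝔭` — and condition (d) holds because an element of `∏_𝔭 Q_𝔭`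
whose support lies in `Supp(fmap b)` is supported on the (finite) support of `b`, hence glues to an element
of `Q` (`cond : Factorization.Cond (⊕_i M_i)`).  The argument is the one of `RlfPerfFactorial.lean` for `M^rlf`.
Seat abc-iut-L1-d2 (cell abc-iut); sub-DAG row FrdI:Thm6.4(i)/T64i-L02.
-/

noncomputable section

namespace Literature.AlgebraicGeometry.Frobenioids

open Function Literature.AnabelianGeometry.EtaleTheta

universe u v

namespace DirectSum

variable {ι : Type u} {M : ι → Type v} [∀ i, CommMonoid (M i)] [DecidableEq ι]
  (hM : ∀ i, IsMonoprime (M i))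
include hM

/-- `(⊕ M)_𝔭 = {a | supp a ⊆ {idx 𝔭}}`. [cite: MochizukiFrdI2008, §0 p.12] -/
theorem mem_submonoid_iff (P : Primes (directSum M)) (a : directSum M) :
    a ∈ P.submonoid ↔ dsupp (a : ∀ j, M j) ⊆ {idx hM P} := by
  have := mem_submonoid_primeOf_iff hM (idx hM P) a
  rwa [primeOf_idx] at this

/-- An element of `(⊕ M)_𝔭` has trivial components away from `idx 𝔭`. [cite: MochizukiFrdI2008, §0 p.12] -/
theorem apply_eq_one_of_mem_submonoid {P : Primes (directSum M)} {a : directSum M} (ha : a ∈ P.submonoid)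
    {i : ι} (hi : i ≠ idx hM P) : (a : ∀ j, M j) i = 1 := by
  by_contra hne
  exact hi ((mem_submonoid_iff hM P a).mp ha hne)

/-- The restriction `a|_i = single i (a i)` as an element of `(⊕ M)_𝔭` (`i = idx 𝔭`).
[cite: MochizukiFrdI2008, Def. 2.4(i) p.47] -/
def res (P : Primes (directSum M)) (a : directSum M) : Factorization.PAt (directSum M) P :=
  ⟨single (idx hM P) ((a : ∀ j, M j) (idx hM P)), (mem_submonoid_iff hM P _).mpr (dsupp_single_subset _ _)⟩

/-- `res` on underlying elements. [cite: MochizukiFrdI2008, Def. 2.4(i) p.47] -/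
@[simp] theorem coe_res (P : Primes (directSum M)) (a : directSum M) :
    (res hM P a : directSum M) = single (idx hM P) ((a : ∀ j, M j) (idx hM P)) := rfl

/-- `res` is multiplicative. [cite: MochizukiFrdI2008, Def. 2.4(i) p.47] -/
theorem res_mul (P : Primes (directSum M)) (a b : directSum M) : res hM P (a * b) = res hM P a * res hM P b :=
  Subtype.ext (by rw [coe_res, coe_mul, Pi.mul_apply, single_mul]; rfl)

/-- `res 1 = 1`. [cite: MochizukiFrdI2008, Def. 2.4(i) p.47] -/
theorem res_one (P : Primes (directSum M)) : res hM P 1 = 1 :=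
  Subtype.ext (by rw [coe_res, coe_one, Pi.one_apply, single_one]; rfl)

/-- `a|_i ⊗ 1 ∈ Bound_{𝔭 ∪ {0}}(a)`. [cite: MochizukiFrdI2008, Def. 2.4(i) p.47] -/
theorem of_res_mem_bound (P : Primes (directSum M)) (a : directSum M) :
    Realification.of _ (res hM P a) ∈ Factorization.bound (directSum M) P a := by
  have hsh : ∀ i, IsSharp (M i) := fun i => MonoprimeStructure.isSharp (hM i)
  refine ⟨res hM P a, ?_, ?_, rfl⟩
  · by_cases ha : (a : ∀ j, M j) (idx hM P) = 1
    · right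
      show single (idx hM P) ((a : ∀ j, M j) (idx hM P)) = 1
      rw [ha, single_one]
    · left
      have key : single (idx hM P) ((a : ∀ j, M j) (idx hM P)) ∈ (primeOf hM (idx hM P)).carrier := by
        rw [mem_carrier_primeOf_iff]
        exact dsupp_single ha
      rw [primeOf_idx] at key
      exact key
  · show single (idx hM P) ((a : ∀ j, M j) (idx hM P)) ∣ a
    rw [dvd_iff hsh]
    intro j
    by_cases hj : j = idx hM P
    · subst hj
      rw [single_apply_same]
    · rw [single_apply_of_ne hj]
      exact one_dvd _

/-- Every element of `Bound_{𝔭 ∪ {0}}(a)` is `≤ a|_i ⊗ 1`: the supremum is a maximum.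
[cite: MochizukiFrdI2008, Def. 2.4(i) p.47] -/
theorem dvd_of_res_of_mem_bound (P : Primes (directSum M)) (a : directSum M)
    {y : Factorization.RAt (directSum M) P} (hy : y ∈ Factorization.bound (directSum M) P a) :
    y ∣ Realification.of _ (res hM P a) := by
  have hsh : ∀ i, IsSharp (M i) := fun i => MonoprimeStructure.isSharp (hM i)
  obtain ⟨x, _, hxa, rfl⟩ := hy
  apply map_dvd
  -- `x ≤ a|_i` inside `(⊕ M)_𝔭`
  have hdvd : (x : directSum M) ∣ (res hM P a : directSum M) := by
    rw [dvd_iff hsh]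
    intro j
    rw [coe_res]
    by_cases hj : j = idx hM P
    · subst hj
      rw [single_apply_same]
      exact ((dvd_iff hsh _ _).mp hxa) _
    · rw [apply_eq_one_of_mem_submonoid hM x.2 hj]
      exact one_dvd _
  obtain ⟨c, hc⟩ := hdvd
  have hcmem : c ∈ P.submonoid := by
    rw [mem_submonoid_iff hM]
    refine Set.Subset.trans ?_ ((mem_submonoid_iff hM P _).mp (res hM P a).2)
    rw [hc, coe_mul]
    intro j hj hj'
    rw [Pi.mul_apply] at hj'
    exact hj ((hsh j).1 _ (IsUnit.of_mul_eq_one _ (by rw [mul_comm]; exact hj')))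
  exact ⟨⟨c, hcmem⟩, Subtype.ext hc⟩

/-- **`a|_i ⊗ 1 = sup Bound_{𝔭 ∪ {0}}(a)`**: "bounded by `b` iff `b ≥ a|_i ⊗ 1`".
[cite: MochizukiFrdI2008, Def. 2.4(i) p.47] -/
theorem isSup_bound (P : Primes (directSum M)) (a : directSum M) (b : Factorization.RAt (directSum M) P) :
    IsBoundedBy (Factorization.bound (directSum M) P a) b ↔ Realification.of _ (res hM P a) ∣ b :=
  ⟨fun hb => hb _ (of_res_mem_bound hM P a), fun hb _ hy => (dvd_of_res_of_mem_bound hM P a hy).trans hb⟩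

/-- **The factorization map of `⊕_i M_i` is `a ↦ (a|_i ⊗ 1)_𝔭`** (the supremum is attained).
[cite: MochizukiFrdI2008, Def. 2.4(i) p.47] -/
theorem fmap_apply (a : directSum M) (P : Primes (directSum M)) :
    Factorization.fmap (directSum M) a P = Realification.of _ (res hM P a) :=
  divSup_eq_of_isSup (fun _ _ => Realification.dvd_antisymm) (isSup_bound hM P a)

/-- `N → N ⊗ ℝ_{≥0}` is injective on each `(⊕ M)_𝔭` (which is monoprime). [cite: MochizukiFrdI2008, Def. 2.4(i) p.47] -/
theorem of_injective (P : Primes (directSum M)) :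
    Injective (Realification.of (Factorization.PAt (directSum M) P)) :=
  Realification.of_injective (isMonoprime_submonoid hM P)

omit [DecidableEq ι] hM in
/-- Index bookkeeping: the underlying element of `x_𝔭` only depends on `𝔭` up to equality.
[cite: MochizukiFrdI2008, Def. 2.4(i) p.47] -/
theorem coe_apply_congr (x : Factorization.PFactor (directSum M)) {P₁ P₂ : Primes (directSum M)} (e : P₁ = P₂) :
    ((x P₁ : directSum M) : ∀ j, M j) = ((x P₂ : directSum M) : ∀ j, M j) := by
  subst e
  rfl

/-- The candidate preimage for condition (d): glue the `i`-components of the `x_{𝔭(i)}`.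
[cite: MochizukiFrdI2008, Def. 2.4(i) p.47] -/
def glue (x : Factorization.PFactor (directSum M)) : ∀ j, M j :=
  fun i => ((x (primeOf hM i) : directSum M) : ∀ j, M j) i

/-- If `Supp(x ⊗ 1) ⊆ Supp(fmap b)` then `supp(glue x) ⊆ supp(b)`, a finite set, so `glue x ∈ ⊕_i M_i`.
[cite: MochizukiFrdI2008, Def. 2.4(i) p.47] -/
theorem dsupp_glue_subset (x : Factorization.PFactor (directSum M)) (b : directSum M)
    (hx : Factorization.supp (Factorization.pToR (directSum M) x) ⊆
      Factorization.supp (Factorization.fmap (directSum M) b)) :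
    dsupp (glue hM x) ⊆ dsupp (b : ∀ j, M j) := by
  intro i hi
  have hx1 : x (primeOf hM i) ≠ 1 := by
    intro h1
    apply hi
    show ((x (primeOf hM i) : directSum M) : ∀ j, M j) i = 1
    rw [h1]
    rfl
  have hP : primeOf hM i ∈ Factorization.supp (Factorization.pToR (directSum M) x) := by
    intro h1
    rw [Factorization.pToR_apply] at h1
    exact hx1 (of_injective hM _ (by rw [h1, map_one]))
  have hb := hx hP
  intro hbi
  apply hb
  rw [fmap_apply hM]
  have : res hM (primeOf hM i) b = 1 := by
    apply Subtype.ext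
    show single (idx hM (primeOf hM i)) ((b : ∀ j, M j) (idx hM (primeOf hM i))) = 1
    rw [idx_primeOf, hbi, single_one]
  rw [this, map_one]

/-- The glued element of `⊕_i M_i`. [cite: MochizukiFrdI2008, Def. 2.4(i) p.47] -/
def glued (x : Factorization.PFactor (directSum M)) (b : directSum M)
    (hx : Factorization.supp (Factorization.pToR (directSum M) x) ⊆
      Factorization.supp (Factorization.fmap (directSum M) b)) : directSum M :=
  ⟨glue hM x, (finite_dsupp b).subset (dsupp_glue_subset hM x b hx)⟩

/-- `res 𝔭 (glued x) = x_𝔭`. [cite: MochizukiFrdI2008, Def. 2.4(i) p.47] -/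
theorem res_glued (x : Factorization.PFactor (directSum M)) (b : directSum M)
    (hx : Factorization.supp (Factorization.pToR (directSum M) x) ⊆
      Factorization.supp (Factorization.fmap (directSum M) b))
    (P : Primes (directSum M)) : res hM P (glued hM x b hx) = x P := by
  apply Subtype.ext
  apply Subtype.ext
  funext j
  show (single (idx hM P) (glue hM x (idx hM P)) : ∀ j, M j) j = ((x P : directSum M) : ∀ j, M j) j
  by_cases hj : j = idx hM P
  · subst hj
    rw [single_apply_same, glue, coe_apply_congr x (primeOf_idx hM P)]
  · rw [single_apply_of_ne hj, apply_eq_one_of_mem_submonoid hM (x P).2 hj]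

/-- `a|_i` for all `𝔭` determine `a`. [cite: MochizukiFrdI2008, Def. 2.4(i) p.47] -/
theorem eq_of_res_eq {a b : directSum M} (hab : ∀ P, res hM P a = res hM P b) : a = b := by
  apply Subtype.ext
  funext i
  have h1 := congrArg (fun z : Factorization.PAt (directSum M) (primeOf hM i) => ((z : directSum M) : ∀ j, M j) i)
    (hab (primeOf hM i))
  simp only [coe_res] at h1
  rwa [idx_primeOf, single_apply_same, single_apply_same] at h1

/-- **Conditions (c), (d) of Def. 2.4 (i) for `⊕_i M_i` (monoprime `M_i`) relative to its own primes.**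
[cite: MochizukiFrdI2008, Def. 2.4(i) p.47] -/
theorem cond : Factorization.Cond (directSum M) where
  bounded P a := ⟨_, (isSup_bound hM P a _).mpr dvd_rfl⟩
  fmap_one := funext fun P => by rw [fmap_apply hM, res_one, map_one, Pi.one_apply]
  fmap_mul a b := funext fun P => by
    rw [Pi.mul_apply, fmap_apply hM, fmap_apply hM, fmap_apply hM, res_mul, map_mul]
  fmap_injective a b hab := by
    apply eq_of_res_eq hM
    intro P
    have h1 := congr_fun hab P
    rw [fmap_apply hM, fmap_apply hM] at h1
    exact of_injective hM _ h1
  fmap_mem_range a := ⟨fun P => res hM P a, funext fun P => by rw [Factorization.pToR_apply, fmap_apply hM]⟩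
  mem_range_of_supp_subset x b hx := ⟨glued hM x b hx, funext fun P => by
    rw [fmap_apply hM, Factorization.pToR_apply, res_glued]⟩

end DirectSum

end Literature.AlgebraicGeometry.Frobenioids
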